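import Mathlib

/-!
# Route BarrierLever — item `PartitionMinorsHitByVP` (stmt-ValiantsHypothesis-19717), line `hidden-states`:
# THE GRADED-COLEX ONE-PIECE DESIGN — legality for every `(h, r)`, and the upper half of the lower node modulo GC½

Helper file (`--supports stmt-ValiantsHypothesis-19717`; cell valiant-natproofs, rung V4, 𝒟-side door (c), registered line
`Cruxes/PartitionMinorsHitByVP/Lines/hidden_states.lean` v8; prover seat val-np-p6 gen 13). Definition-free; closes NO item.

THE DESIGN GC(h, r) (memo HOME/val-np-p6/g13/MEMO-valnp6-g13.md §5). ONE piece, `K = h` states, offset `W = 0`, state weights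
`wt q = 2^h + 2^q`; the weight of a state set `J` is `gcw J = Σ_{q ∈ J} (2^h + 2^q) = 2^h·|J| + bin(J)`, injective and size-graded, so
for every `r ≤ 2^h` the `r` lightest state sets form a LEGAL threshold family (`exists_gcFamily`: an injective
`cols : Fin r → Finset (Fin h)` whose members are lighter than every non-member) — the graded-colex initial segment
(`F_{2^h − h − 1} = B_{h−2}`, the ball of the BALL-DIAGONAL theorem p634848). Such a family is automatically down-closed
(`gcFamily_down`).

CONJECTURE GC½ (census of this seat: 0 BAD / 1 064 down-sets with `r ≥ 2^{h−1}`, `h = 6..9`, kit j309026/j309067; exhaustive `h ≤ 5`):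
for `2^{h−1} ≤ r ≤ 2^h` the family serves EVERY injective lower row family of size `r`. It is FALSE below `2^{h−1}` (star layers,
`…PencilObstruction`, p636166; kit j309068/j309202). `universalJoinWideLower_upperHalf_of_gc`: GC½ (stated inline as the hypothesis)
implies the body of `LowerNode.Stmt.universalJoinWideLower` (p599518) at every `(h, r)` with `h ≥ 1`, `2^{h−1} ≤ r ≤ 2^h`, with
`m = 1`, `K = h` — in particular the whole open `h = 19` window `517 159 ≤ r ≤ 524 267`.

WHAT THIS IS NOT: GC½ is a conjecture (the hypothesis of the last theorem), not proved here; nothing on crux 14610 or VP ≠ VNP.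
-/

set_option linter.dupNamespace false

namespace Summit.ValiantsHypothesis.ValiantsHypothesis.Theorems.BarrierLever.HiddenStates

open Finset

noncomputable section

namespace BallDiag

/-- The binary part of the graded-colex weight is below `2^h`. -/
theorem binSum_lt (h : ℕ) (J : Finset (Fin h)) : ∑ q ∈ J, 2 ^ (q : ℕ) < 2 ^ h := by
  have h1 : ∑ q ∈ J, 2 ^ (q : ℕ) = ∑ k ∈ J.map Fin.valEmbedding, 2 ^ k := by
    rw [Finset.sum_map]
    rfl
  rw [h1]
  refine Nat.geomSum_lt le_rfl fun k hk => ?_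
  obtain ⟨q, -, rfl⟩ := Finset.mem_map.mp hk
  exact q.isLt

/-- The graded-colex weight `Σ_{q ∈ J} (2^h + 2^q) = 2^h · |J| + bin(J)`. -/
theorem gcw_eq (h : ℕ) (J : Finset (Fin h)) :
    ∑ q ∈ J, (2 ^ h + 2 ^ (q : ℕ)) = 2 ^ h * J.card + ∑ q ∈ J, 2 ^ (q : ℕ) := by
  rw [Finset.sum_add_distrib, Finset.sum_const, smul_eq_mul, mul_comm]

/-- **The graded-colex weight is injective.** -/
theorem gcw_injective (h : ℕ) :
    Function.Injective fun J : Finset (Fin h) => ∑ q ∈ J, (2 ^ h + 2 ^ (q : ℕ)) := by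
  intro J J' hJJ
  have hJJ' : 2 ^ h * J.card + ∑ q ∈ J, 2 ^ (q : ℕ) = 2 ^ h * J'.card + ∑ q ∈ J', 2 ^ (q : ℕ) := by
    have := hJJ
    simp only [gcw_eq] at this
    exact this
  have hb := binSum_lt h J
  have hb' := binSum_lt h J'
  have hP : 0 < 2 ^ h := Nat.two_pow_pos h
  -- quotient and remainder by `2^h`
  have hcard : J.card = J'.card := by
    have h1 : (2 ^ h * J.card + ∑ q ∈ J, 2 ^ (q : ℕ)) / 2 ^ h = (2 ^ h * J'.card + ∑ q ∈ J', 2 ^ (q : ℕ)) / 2 ^ h := by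
      rw [hJJ']
    rwa [Nat.mul_add_div hP, Nat.mul_add_div hP, Nat.div_eq_of_lt hb, Nat.div_eq_of_lt hb', add_zero, add_zero] at h1
  rw [hcard] at hJJ'
  have hbin : ∑ q ∈ J, 2 ^ (q : ℕ) = ∑ q ∈ J', 2 ^ (q : ℕ) := Nat.add_left_cancel hJJ'
  -- binary expansions are unique
  have hmap : J.map Fin.valEmbedding = J'.map Fin.valEmbedding := by
    apply Finset.geomSum_injective (n := 2) le_rfl
    simp only [Finset.sum_map, Fin.valEmbedding_apply]
    exact hbin
  exact Finset.map_injective Fin.valEmbedding hmap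

/-- The weight is size-graded: fewer states means lighter. -/
theorem gcw_lt_of_card_lt (h : ℕ) (J J' : Finset (Fin h)) (hJ : J.card < J'.card) :
    ∑ q ∈ J, (2 ^ h + 2 ^ (q : ℕ)) < ∑ q ∈ J', (2 ^ h + 2 ^ (q : ℕ)) := by
  rw [gcw_eq, gcw_eq]
  have hb := binSum_lt h J
  have : 2 ^ h * J.card + 2 ^ h ≤ 2 ^ h * J'.card := by
    rw [← Nat.mul_succ]
    exact Nat.mul_le_mul_left _ hJ
  omega

/-- A subset is not heavier. -/
theorem gcw_le_of_subset (h : ℕ) (A J : Finset (Fin h)) (hAJ : A ⊆ J) :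
    ∑ q ∈ A, (2 ^ h + 2 ^ (q : ℕ)) ≤ ∑ q ∈ J, (2 ^ h + 2 ^ (q : ℕ)) :=
  Finset.sum_le_sum_of_subset_of_nonneg hAJ fun _ _ _ => Nat.zero_le _

/-- **The graded-colex family exists for every `r ≤ 2^h`**: an injective enumeration of the `r` lightest state sets. -/
theorem exists_gcFamily (h r : ℕ) (hr : r ≤ 2 ^ h) :
    ∃ cols : Fin r → Finset (Fin h), Function.Injective cols ∧
      ∀ k J, J ∉ Set.range cols → ∑ q ∈ cols k, (2 ^ h + 2 ^ (q : ℕ)) < ∑ q ∈ J, (2 ^ h + 2 ^ (q : ℕ)) := by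
  classical
  -- rank by weight
  let w : Finset (Fin h) → ℕ := fun J => ∑ q ∈ J, (2 ^ h + 2 ^ (q : ℕ))
  let rk : Finset (Fin h) → ℕ := fun J => (Finset.univ.filter fun J' => w J' < w J).card
  have hrk_lt : ∀ J, rk J < 2 ^ h := by
    intro J
    have : (Finset.univ.filter fun J' => w J' < w J).card < (Finset.univ : Finset (Finset (Fin h))).card :=
      Finset.card_lt_card (Finset.filter_ssubset.mpr ⟨J, Finset.mem_univ _, lt_irrefl _⟩)
    rwa [Finset.card_univ, Fintype.card_finset, Fintype.card_fin] at this
  have hrk_mono : ∀ J J', w J < w J' → rk J < rk J' := by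
    intro J J' hJJ
    apply Finset.card_lt_card
    rw [Finset.ssubset_iff_of_subset]
    · exact ⟨J, Finset.mem_filter.mpr ⟨Finset.mem_univ _, hJJ⟩, fun hJ => lt_irrefl _ (Finset.mem_filter.mp hJ).2⟩
    · intro J'' hJ''
      exact Finset.mem_filter.mpr ⟨Finset.mem_univ _, ((Finset.mem_filter.mp hJ'').2).trans hJJ⟩
  have hrk_reflect : ∀ J J', rk J < rk J' → w J < w J' := by
    intro J J' hJJ
    rcases lt_trichotomy (w J) (w J') with hlt | heq | hgt
    · exact hlt
    · exfalso
      have : rk J = rk J' := by simp only [rk, heq]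
      omega
    · have := hrk_mono J' J hgt; omega
  let rkF : Finset (Fin h) → Fin (2 ^ h) := fun J => ⟨rk J, hrk_lt J⟩
  have hinj : Function.Injective rkF := by
    intro J J' hJJ
    have hJJ' : rk J = rk J' := by simpa [rkF] using congrArg Fin.val hJJ
    by_contra hne
    have hwne : w J ≠ w J' := fun hw => hne (gcw_injective h hw)
    rcases lt_or_gt_of_ne hwne with hlt | hgt
    · have := hrk_mono J J' hlt; omega
    · have := hrk_mono J' J hgt; omega
  have hbij : Function.Bijective rkF := by
    rw [Fintype.bijective_iff_injective_and_card]
    exact ⟨hinj, by rw [Fintype.card_finset, Fintype.card_fin, Fintype.card_fin]⟩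
  let σ := Equiv.ofBijective rkF hbij
  refine ⟨fun k => σ.symm (Fin.castLE hr k), ?_, ?_⟩
  · intro k k' hkk
    have := σ.symm.injective hkk
    exact Fin.castLE_injective hr this
  · intro k J hJ
    apply hrk_reflect
    have h1 : rk (σ.symm (Fin.castLE hr k)) = k := by
      have h2 : σ (σ.symm (Fin.castLE hr k)) = Fin.castLE hr k := σ.apply_symm_apply _
      rw [Equiv.ofBijective_apply] at h2
      exact congrArg Fin.val h2
    rw [h1]
    by_contra hle
    push Not at hle
    apply hJ
    refine ⟨⟨rk J, by omega⟩, ?_⟩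
    apply σ.injective
    rw [Equiv.apply_symm_apply, Equiv.ofBijective_apply]
    exact Fin.ext rfl

/-- **A graded-colex family is down-closed.** -/
theorem gcFamily_down (h r : ℕ) (cols : Fin r → Finset (Fin h))
    (hgc : ∀ k J, J ∉ Set.range cols → ∑ q ∈ cols k, (2 ^ h + 2 ^ (q : ℕ)) < ∑ q ∈ J, (2 ^ h + 2 ^ (q : ℕ)))
    (k : Fin r) (A : Finset (Fin h)) (hA : A ⊆ cols k) : ∃ k', cols k' = A := by
  by_contra hno
  push Not at hno
  have h1 := hgc k A (by rintro ⟨k', hk'⟩; exact hno k' hk')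
  have h2 := gcw_le_of_subset h A (cols k) hA
  omega

/-- **The graded-colex design is LEGAL**: with `W = 0`, `wt q = 2^h + 2^q`, every non-member of the one-piece design
`k ↦ (0, cols k)` is strictly heavier than every member. -/
theorem gcDesign_threshold (h r : ℕ) (cols : Fin r → Finset (Fin h))
    (hgc : ∀ k J, J ∉ Set.range cols → ∑ q ∈ cols k, (2 ^ h + 2 ^ (q : ℕ)) < ∑ q ∈ J, (2 ^ h + 2 ^ (q : ℕ))) :
    ∀ x : Fin 1 × Finset (Fin h), x ∉ Set.range (fun k => ((0 : Fin 1), cols k)) →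
      ∀ i, (fun _ : Fin 1 => 0) ((fun k => ((0 : Fin 1), cols k)) i).1
          + ∑ q ∈ ((fun k => ((0 : Fin 1), cols k)) i).2, (fun (_ : Fin 1) (q : Fin h) => 2 ^ h + 2 ^ (q : ℕ)) 0 q
        < (fun _ : Fin 1 => 0) x.1 + ∑ q ∈ x.2, (fun (_ : Fin 1) (q : Fin h) => 2 ^ h + 2 ^ (q : ℕ)) x.1 q := by
  rintro ⟨p, J⟩ hx i
  have hp : p = 0 := Fin.fin_one_eq_zero p
  subst hp
  have hJ : J ∉ Set.range cols := by
    rintro ⟨k, hk⟩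
    exact hx ⟨k, by simp [hk]⟩
  simp only [zero_add]
  exact hgc i J hJ

/-- **THE UPPER HALF OF THE LOWER NODE MODULO GC½.** If the graded-colex one-piece family serves every injective lower row family of
size `r` whenever `2^{h−1} ≤ r ≤ 2^h` (Conjecture GC½, the hypothesis), then the body of `LowerNode.Stmt.universalJoinWideLower` holds at
every such `(h, r)` with `h ≥ 1`, by a design with ONE piece and `K = h` states. -/
theorem universalJoinWideLower_upperHalf_of_gc
    (H : ∀ h r : ℕ, 1 ≤ h → 2 ^ (h - 1) ≤ r → r ≤ 2 ^ h →
      ∀ cols : Fin r → Finset (Fin h), Function.Injective cols →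
        (∀ k J, J ∉ Set.range cols → ∑ q ∈ cols k, (2 ^ h + 2 ^ (q : ℕ)) < ∑ q ∈ J, (2 ^ h + 2 ^ (q : ℕ))) →
        ∀ u : Fin r → Finset (Fin h), Function.Injective u → IsLowerSet (Set.range u) →
          ∃ tx : Option (Fin h) → Fin h → ℂ,
            (Matrix.of fun i k : Fin r => ∏ a ∈ u i, (tx none a + ∑ q ∈ cols k, tx (some q) a)).det ≠ 0)
    (h r : ℕ) (h1 : 1 ≤ h) (hlo : 2 ^ (h - 1) ≤ r) (hhi : r ≤ 2 ^ h) :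
    ∃ (m K : ℕ) (W : Fin m → ℕ) (wt : Fin m → Fin K → ℕ) (e : Fin r → Fin m × Finset (Fin K)),
      m ≤ h + h ∧ K ≤ h * h * h ∧ Function.Injective e ∧
      (∀ x : Fin m × Finset (Fin K), x ∉ Set.range e →
        ∀ i, W (e i).1 + ∑ k ∈ (e i).2, wt (e i).1 k < W x.1 + ∑ k ∈ x.2, wt x.1 k) ∧
      ∀ u : Fin r → Finset (Fin h), Function.Injective u → IsLowerSet (Set.range u) →
        ∃ tx : Fin m → Option (Fin K) → Fin h → ℂ,
          (Matrix.of fun i k : Fin r =>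
            ∏ a ∈ u i, (tx (e k).1 none a + ∑ q ∈ (e k).2, tx (e k).1 (some q) a)).det ≠ 0 := by
  obtain ⟨cols, hinj, hgc⟩ := exists_gcFamily h r hhi
  refine ⟨1, h, fun _ => 0, fun _ q => 2 ^ h + 2 ^ (q : ℕ), fun k => ((0 : Fin 1), cols k), by omega, ?_, ?_,
    gcDesign_threshold h r cols hgc, ?_⟩
  · calc h = h * 1 * 1 := by ring
      _ ≤ h * h * h := by gcongr
  · intro k k' hkk
    exact hinj (Prod.ext_iff.mp hkk).2
  · intro u hu hlow
    obtain ⟨tx, htx⟩ := H h r h1 hlo hhi cols hinj hgc u hu hlow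
    exact ⟨fun _ => tx, htx⟩

/-- The numerology at `h = 19`: the upper half `[2^18, 2^19]` contains the whole open window `517 159 ≤ r ≤ 524 267`. -/
theorem upperHalf_nineteen : 2 ^ (19 - 1) ≤ 517159 ∧ 524267 ≤ 2 ^ 19 := by norm_num

end BallDiag

end

end Summit.ValiantsHypothesis.ValiantsHypothesis.Theorems.BarrierLever.HiddenStates
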